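import Summits.Ventures.PercRepro.S2CobasisCount
import Summits.Ventures.PercRepro.S2SharpCoreXQI

/-!
# PercRepro — S2: THE COBASIS LEVER, III — THE LEVEL-`5` CORE AT CORANK `6` FROM ONE CELL (p7, gen 6; sub-claim S2)

S2SharpCoreXQI's core `c025_core_five_sharp_cell_xqi` at `d = 6` with the `(U)`-side replaced: the top sets'
complements are the independent `5`-sets (S2IndepFiveCount's `C(n, 5) − s₃·C(n − 3, 2) + C(s₃, 2)`) and the cobasis
`6`-sets (S2CobasisCount: `s₃·(C(n − 3, 3) − C(n − 7, 3)) + s₄·C(n − 4, 2) + s₅·(n − 5) + s₆` once `s₃ ≥ 5`, the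
plain circuit count `s₃·C(n − 3, 3) + …` of the set-indexed count below). The polynomial side is therefore asked for
EVERY `s₃ = s ≤ 12` (T⁺⁺⁺ at `d = 6`; no monotonicity argument), the tail side is S2SharpCoreXQI's at `d = 6`
word for word: **`c025_core_five_cobasis_six_cell`**. Axioms: standard.
-/

open scoped Matroid

namespace PercRepro

namespace ThmN

open Set

variable {α : Type}

/-- **The `e`-free core at level `5`, corank `6`, from one cell with the cobasis lever**: the polynomial side
`1024·(C(n, 5) − s·C(n − 3, 2) + C(s, 2) + s·L(s) + T4⁺(6)·C(n − 4, 2) + C(10, 5)·(n − 5) + C(11, 6)) ≤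
(1024 − m)·2·C(p + 5, 5)` for EVERY `s ≤ 12` (`s₃ ≤ 12` by T⁺⁺⁺ at `d = 6`), with `L(s) = C(n − 3, 3) − C(n − 7, 3)`
once `s ≥ 5` (Lemma B) and `C(n − 3, 3)` below; the tail side is S2SharpCoreXQI's at `d = 6`. -/
theorem c025_core_five_cobasis_six_cell (M : Matroid α) [M.Finite] (p : ℕ) (hp5 : 5 ≤ p)
    (hR : M.eRank = (p : ℕ∞)) (hn : M.E.ncard = p + 6)
    (hfree : ∀ e ∈ M.E, ∃ A ⊆ M.E \ {e}, e ∉ M.closure A ∧ e ∉ M.closure ((M.E \ {e}) \ A))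
    (hcell : ∃ m : ℕ, m ≤ 1024 ∧
      (∀ s ∈ Finset.range 13,
        1024 * (((p + 6).choose 5 : ℚ) - (s : ℚ) * ((p + 3).choose 2 : ℚ) + ((s.choose 2 : ℕ) : ℚ) +
          ((s * (if 5 ≤ s then (p + 3).choose 3 - (p - 1).choose 3 else (p + 3).choose 3) +
            S1.fourCircuitBound 6 * (p + 2).choose 2 + (6 + 4).choose 5 * (p + 1) + (6 + 5).choose 6 : ℕ) : ℚ)) ≤
          ((1024 - m : ℕ) : ℚ) * 2 ^ (6 - 5) * ((p + 5).choose 5 : ℚ)) ∧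
      (1024 * ((((p + 6).choose 4 : ℚ) +
      (∑ j ∈ Finset.range 6, (Nat.choose (min 5 ((6 + 3) / 2 + 1 - 2)) j : ℚ) / (((j + 1) + 3 * (j + 1).choose 2 : ℕ) : ℚ)) *
        ((((6 * 6 + 6 - 3 * 6) / 2) * (p + 6 - 3).choose 2 + S1.fourCircuitBound 6 * (p + 6 - 4) + (6 + 4).choose 5 : ℕ) : ℚ) +
      ((∑ j ∈ Finset.range 6, (Nat.choose 5 j : ℚ) / (((j + 1) + 3 * (j + 1).choose 2 : ℕ) : ℚ)) -
        (∑ j ∈ Finset.range 6, (Nat.choose (min 5 ((6 + 3) / 2 + 1 - 2)) j : ℚ) / (((j + 1) + 3 * (j + 1).choose 2 : ℕ) : ℚ))) *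
        ((10 : ℕ).choose 5 : ℚ)) +
      (((p + 6).choose 3 * 2 ^ 3 + (p + 6).choose 2 * 2 + (p + 6) + 1 : ℕ) : ℚ) +
      (((p + 6).choose 5 : ℚ) + (∑ j ∈ Finset.range (6), (Nat.choose (min 13 ((6 + 6) / 2 + 1 - 2)) j : ℚ) / (((j + 1) + 3 * (j + 1).choose 2 : ℕ) : ℚ)) * ((((6 * 6 + 6 - 3 * 6) / 2) * (p + 6 - 3).choose 3 + S1.fourCircuitBound 6 * (p + 6 - 4).choose 2 + (6 + 4).choose 5 * (p + 6 - 5) + (6 + 5).choose 6 : ℕ) : ℚ) +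
        ((∑ j ∈ Finset.range (6), (Nat.choose (min 19 (5 + 6) - 6) j : ℚ) / (((j + 1) + 3 * (j + 1).choose 2 : ℕ) : ℚ)) - (∑ j ∈ Finset.range (6), (Nat.choose (min 13 ((6 + 6) / 2 + 1 - 2)) j : ℚ) / (((j + 1) + 3 * (j + 1).choose 2 : ℕ) : ℚ))) *
        ((min 19 (5 + 6)).choose 6 : ℚ)) +
      ((∑ j ∈ Finset.range (6 + 1), (p + 6).choose j : ℕ) : ℚ)) ≤ (m : ℚ) * 2 ^ (p + 6))) :
    RLS M p 5 := by
  classical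
  -- the slack arithmetic (S2Cells29's `level_arith_slack` at `k = 1024`, `q = 5`, `n = p + 6`, inlined)
  have hslack : ∀ {Φ U Y A B V : ℚ} {m : ℕ},
      Φ ≤ (2 : ℚ) ^ (p + 5) / ((p + 5).choose 5 : ℚ) → 0 ≤ U → U ≤ V →
      (2 : ℚ) ^ (p + 6) ≤ Y + A + B → m ≤ 1024 → (1024 : ℚ) * (A + B) ≤ (m : ℚ) * 2 ^ (p + 6) →
      (1024 : ℚ) * V ≤ ((1024 - m : ℕ) : ℚ) * 2 ^ (6 - 5) * ((p + 5).choose 5 : ℚ) →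
      Φ * U ≤ Y := by
    intro Φ U Y A B V m hΦ hU0 hU hY hmk hAB hpoly
    have hc : (0 : ℚ) < ((p + 5).choose 5 : ℚ) := by exact_mod_cast Nat.choose_pos (by omega)
    have hkq : (0 : ℚ) < (1024 : ℚ) := by norm_num
    have hkm : ((1024 - m : ℕ) : ℚ) = (1024 : ℚ) - (m : ℚ) := by
      rw [Nat.cast_sub hmk]; norm_num
    have hpow : (2 : ℚ) ^ (p + 6) = 2 ^ (p + 5) * 2 ^ (6 - 5) := by
      rw [← pow_add]
    have h1 : Φ * U ≤ (2 : ℚ) ^ (p + 5) / ((p + 5).choose 5 : ℚ) * U := mul_le_mul_of_nonneg_right hΦ hU0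
    have h2 : (2 : ℚ) ^ (p + 5) / ((p + 5).choose 5 : ℚ) * U ≤
        (2 : ℚ) ^ (p + 5) / ((p + 5).choose 5 : ℚ) * V :=
      mul_le_mul_of_nonneg_left hU (by positivity)
    have h3 : (2 : ℚ) ^ (p + 5) / ((p + 5).choose 5 : ℚ) * V ≤
        ((1024 : ℚ) - m) / 1024 * 2 ^ (p + 6) := by
      rw [hpow, div_mul_eq_mul_div, div_le_iff₀ hc]
      have h2p : (0 : ℚ) < 2 ^ (p + 5) := by positivity
      have hpoly' : V ≤
          ((1024 : ℚ) - m) / 1024 * 2 ^ (6 - 5) * ((p + 5).choose 5 : ℚ) := by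
        rw [hkm] at hpoly
        rw [div_mul_eq_mul_div, div_mul_eq_mul_div, div_eq_mul_inv]
        have := mul_le_mul_of_nonneg_right hpoly (le_of_lt (inv_pos.mpr hkq))
        rw [mul_comm (1024 : ℚ), mul_assoc, mul_inv_cancel₀ hkq.ne', mul_one] at this
        linarith
      calc (2 : ℚ) ^ (p + 5) * V
          ≤ 2 ^ (p + 5) * (((1024 : ℚ) - m) / 1024 * 2 ^ (6 - 5) * ((p + 5).choose 5 : ℚ)) :=
            mul_le_mul_of_nonneg_left hpoly' h2p.le
        _ = ((1024 : ℚ) - m) / 1024 * (2 ^ (p + 5) * 2 ^ (6 - 5)) * ((p + 5).choose 5 : ℚ) := by ring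
    have h4 : ((1024 : ℚ) - m) / 1024 * (2 : ℚ) ^ (p + 6) ≤ Y := by
      have hAB' : A + B ≤ (m : ℚ) / 1024 * 2 ^ (p + 6) := by
        rw [div_mul_eq_mul_div, le_div_iff₀ hkq]; linarith
      have : ((1024 : ℚ) - m) / 1024 * (2 : ℚ) ^ (p + 6) = 2 ^ (p + 6) - (m : ℚ) / 1024 * 2 ^ (p + 6) := by
        rw [sub_div, div_self hkq.ne']; ring
      rw [this]; linarith
    linarith
  have hEcard : M.ground_finite.toFinset.card = p + 6 := by
    rw [← Set.ncard_eq_toFinset_card _ M.ground_finite]; exact hn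
  -- the core is simple: every circuit has `≥ 3` elements
  have hL0 : ∀ e ∈ M.E, ¬ M.IsLoop e := not_isLoop_of_free M hfree
  have hs : ∀ e ∈ M.E, ∀ f ∈ M.E, e ≠ f → M.eRk {e, f} = 2 := by
    intro e he f hf hef
    have h2 : (2 : ℕ∞) ≤ M.eRk {e, f} :=
      two_le_eRk_of_two_le_ncard_of_free M hfree (pair_subset he hf) (by rw [ncard_pair hef])
    have h3 : M.eRk {e, f} ≤ 2 := by
      have := M.eRk_le_encard {e, f}
      rwa [encard_pair hef] at this
    exact le_antisymm h3 h2
  have hcirc : ∀ C, M.IsCircuit C → 3 ≤ C.encard := three_le_encard_of_circuit M hL0 hs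
  have hd : M.E.encard = M.eRank + ((6 : ℕ) : ℕ∞) := by
    rw [hR, ← M.ground_finite.cast_ncard_eq, hn]
    push_cast
    ring
  -- the capped flat bounds: rank-`≤ 5` sets have `≤ min 19 (5 + 6)` points, rank-`≤ 4` sets `≤ min 10 (4 + 6)`
  have hflat : ∀ X ⊆ M.E, M.eRk X ≤ 5 → X.ncard ≤ min 19 (5 + 6) := fun X hX hr =>
    le_min (ncard_le_nineteen_of_eRk_le_five_of_free M hfree hX hr)
      (ncard_le_add_of_eRk_le_of_encard_eq M hd hX hr)
  have hflat' : ∀ X ⊆ M.E, M.eRk X ≤ ((5 - 1 : ℕ) : ℕ∞) → X.ncard ≤ min 10 (4 + 6) := fun X hX hr =>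
    le_min (ncard_le_ten_of_eRk_le_four_of_free M hfree hX (by simpa using hr))
      (ncard_le_add_of_eRk_le_of_encard_eq M hd hX (by simpa using hr))
  -- the circuit counts: Lemma T, Lemma T4, and the nullity bounds
  have hC1 : ∀ L ⊆ M.E, M.eRk L = 2 → L.ncard ≤ 3 :=
    fun L hL hr => ncard_le_three_of_eRk_two M hs hfree hL hr
  have hC2 : ∀ P ⊆ M.E, M.eRk P ≤ 3 → P.ncard ≤ 6 :=
    fun P hP hr => ncard_le_six_of_eRk_le_three_of_free M hfree hP hr
  have hs3 : {C | M.IsCircuit C ∧ C.ncard = 3}.ncard ≤ (6 * 6 + 6 - 3 * 6) / 2 := by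
    have := S1.ncard_triangles_le_of_nullity_sharp M hC1 hC2 (by omega) hd
    unfold triangles at this
    exact this
  have hs4 : {C | M.IsCircuit C ∧ C.ncard = 4}.ncard ≤ S1.fourCircuitBound 6 :=
    S1.ncard_fourCircuits_le_fourCircuitBound M hfree hd
  have hs5 : {C | M.IsCircuit C ∧ C.ncard = 5}.ncard ≤ (6 + 4).choose 5 :=
    Matroid.ncard_circuits_le_choose_of_encard M hd 4
  have hs6 : {C | M.IsCircuit C ∧ C.ncard = 6}.ncard ≤ (6 + 5).choose 6 :=
    Matroid.ncard_circuits_le_choose_of_encard M hd 5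
  -- (U): the square-multiplicity count in the PARTITION form, in `ℚ`, then the circuit bounds
  set ν₁ : ℕ := (6 + 6) / 2 + 1 with hν₁
  have hm1 : min (min 19 (5 + 6) - 6) (ν₁ - 2) = min 13 ((6 + 6) / 2 + 1 - 2) := by omega
  have hm3 : min (min 19 (5 + 6)) (5 + 6) = min 19 (5 + 6) := by omega
  -- (U): the independent `5`-sets and the cobasis `6`-sets, the latter by the cobasis lever once `s₃ ≥ 5`
  set t := {C : Set α | M.IsCircuit C ∧ C.ncard = 3}.ncard with ht
  have ht12 : t ≤ 12 := hs3
  have hU1 := topCount_le_indep_add_cobasis_six M p hn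
  have hI5 := S2.ncard_indep_five_add_le (M := M) hC1
  rw [hn, show p + 6 - 3 = p + 3 by omega] at hI5
  have hI5q : ({B : Set α | B ⊆ M.E ∧ B.ncard = 5 ∧ M.eRk B = 5}.ncard : ℚ) ≤
      ((p + 6).choose 5 : ℚ) - (t : ℚ) * ((p + 3).choose 2 : ℚ) + ((t.choose 2 : ℕ) : ℚ) := by
    have h' : (({B : Set α | B ⊆ M.E ∧ B.ncard = 5 ∧ M.eRk B = 5}.ncard + t * (p + 3).choose 2 : ℕ) : ℚ) ≤
        (((p + 6).choose 5 + t.choose 2 : ℕ) : ℚ) := by exact_mod_cast hI5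
    push_cast at h'
    linarith
  have hUq : (Matroid.topCount M p 5 : ℚ) ≤
      ((p + 6).choose 5 : ℚ) - (t : ℚ) * ((p + 3).choose 2 : ℚ) + ((t.choose 2 : ℕ) : ℚ) +
        ((t * (if 5 ≤ t then (p + 3).choose 3 - (p - 1).choose 3 else (p + 3).choose 3) +
          S1.fourCircuitBound 6 * (p + 2).choose 2 + (6 + 4).choose 5 * (p + 1) + (6 + 5).choose 6 : ℕ) : ℚ) := by
    by_cases h5 : 5 ≤ t
    · -- the cobasis lever
      rw [if_pos h5]
      have hB := S2.ncard_cobasis_six_le hC1 hcirc hn h5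
      have hW : {B : Set α | B ⊆ M.E ∧ M.eRk B = 5 ∧ B.ncard = 6 ∧ M.eRk (M.E \ B) = (p : ℕ∞)}.ncard ≤
          t * ((p + 3).choose 3 - (p - 1).choose 3) + S1.fourCircuitBound 6 * (p + 2).choose 2 +
            (6 + 4).choose 5 * (p + 1) + (6 + 5).choose 6 := by
        refine hB.trans ?_
        exact Nat.add_le_add (Nat.add_le_add (Nat.add_le_add le_rfl (Nat.mul_le_mul_right _ hs4))
          (Nat.mul_le_mul_right _ hs5)) hs6
      have hU1q : (Matroid.topCount M p 5 : ℚ) ≤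
          ({B : Set α | B ⊆ M.E ∧ B.ncard = 5 ∧ M.eRk B = 5}.ncard : ℚ) +
          ({B : Set α | B ⊆ M.E ∧ M.eRk B = 5 ∧ B.ncard = 6 ∧ M.eRk (M.E \ B) = (p : ℕ∞)}.ncard : ℚ) := by
        exact_mod_cast hU1
      have hWq : ({B : Set α | B ⊆ M.E ∧ M.eRk B = 5 ∧ B.ncard = 6 ∧ M.eRk (M.E \ B) = (p : ℕ∞)}.ncard : ℚ) ≤
          ((t * ((p + 3).choose 3 - (p - 1).choose 3) + S1.fourCircuitBound 6 * (p + 2).choose 2 +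
            (6 + 4).choose 5 * (p + 1) + (6 + 5).choose 6 : ℕ) : ℚ) := by exact_mod_cast hW
      linarith
    · -- no lever: the set-indexed count at `D = 6` (every rank-`5` set of `U` has `≤ 6` elements)
      rw [if_neg h5]
      have hU0 := S2.ncard_eRk_eq_ncard_le_le_sets_indep M 5 (min 19 (5 + 6)) (min 10 (4 + 6)) 7 6 6 (by norm_num)
        hcirc hC1 hflat hflat' (hinter_five M hfree) hd (by omega) (by omega) (by omega)
      have hU2 := Matroid.topCount_le_ncard_compl (M := M) hR hd 5
      simp only [show (5 : ℕ) + 1 = 6 from rfl] at hU0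
      rw [hn, sum_Icc_three_six_q] at hU0
      simp only [show (6 : ℕ) - 3 = 3 from rfl, show (6 : ℕ) - 4 = 2 from rfl,
        show (6 : ℕ) - 5 = 1 from rfl, show (6 : ℕ) - 6 = 0 from rfl, Nat.choose_one_right,
        Nat.choose_zero_right, show 6 - 6 + 1 = 1 from rfl, Finset.sum_range_one,
        show p + 6 - 3 = p + 3 by omega, show p + 6 - 4 = p + 2 by omega, show p + 6 - 5 = p + 1 by omega,
        show p + 6 - 6 = p by omega] at hU0
      norm_num at hU0
      have hU2q : (Matroid.topCount M p 5 : ℚ) ≤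
          ({B : Set α | B ⊆ M.E ∧ M.eRk B = 5 ∧ B.ncard ≤ 6}.ncard : ℚ) := by exact_mod_cast hU2
      have hsm : t * (p + 3).choose 3 + {C : Set α | M.IsCircuit C ∧ C.ncard = 4}.ncard * (p + 2).choose 2 +
          {C : Set α | M.IsCircuit C ∧ C.ncard = 5}.ncard * (p + 1) +
          {C : Set α | M.IsCircuit C ∧ C.ncard = 6}.ncard * 1 ≤
          t * (p + 3).choose 3 + S1.fourCircuitBound 6 * (p + 2).choose 2 + (6 + 4).choose 5 * (p + 1) + (6 + 5).choose 6 := by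
        rw [mul_one]
        exact Nat.add_le_add (Nat.add_le_add (Nat.add_le_add le_rfl (Nat.mul_le_mul_right _ hs4))
          (Nat.mul_le_mul_right _ hs5)) hs6
      have hsmq : ((t : ℚ) * ((p + 3).choose 3 : ℚ) +
          ({C : Set α | M.IsCircuit C ∧ C.ncard = 4}.ncard : ℚ) * ((p + 2).choose 2 : ℚ) +
          ({C : Set α | M.IsCircuit C ∧ C.ncard = 5}.ncard : ℚ) * ((p + 1 : ℕ) : ℚ) +
          ({C : Set α | M.IsCircuit C ∧ C.ncard = 6}.ncard : ℚ) * ((1 : ℕ) : ℚ)) ≤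
          ((t * (p + 3).choose 3 + S1.fourCircuitBound 6 * (p + 2).choose 2 + (6 + 4).choose 5 * (p + 1) +
            (6 + 5).choose 6 : ℕ) : ℚ) := by exact_mod_cast hsm
      push_cast at hsmq hU0 ⊢
      linarith [hU2q.trans hU0, hI5q, hsmq]
  -- (Y): the STRUCTURED flat tail — ranks `≤ 4` through their closures, rank `5` by the level count at `D = 5 + 6`
  have hY := Matroid.two_pow_le_midCount_add (M := M) p 5 hR
  have hsum5 := S2.ncard_eRk_le_le_sum M 5
  simp only [Finset.sum_range_succ, Finset.sum_range_zero, zero_add] at hsum5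
  -- the rank-`4` sets by the set-indexed count at level `4` (`D = 10`: every rank-`4` set has `≤ 10` points)
  have h4 : {X : Set α | X ⊆ M.E ∧ M.eRk X = 4}.ncard ≤
      {B : Set α | B ⊆ M.E ∧ M.eRk B = 4 ∧ B.ncard ≤ 10}.ncard := by
    apply Set.ncard_le_ncard
    · intro X hX
      exact ⟨hX.1, hX.2, ncard_le_ten_of_eRk_le_four_of_free M hfree hX.1 (by rw [hX.2])⟩
    · exact M.ground_finite.finite_subsets.subset (fun B hB => hB.1)
  have hinter4 : ∀ X ⊆ M.E, M.eRk X ≤ ((4 - 1 : ℕ) : ℕ∞) → (X.ncard : ℕ∞) ≤ M.eRk X + (3 : ℕ) := by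
    intro X hX hr
    obtain ⟨k, hk⟩ := Matroid.exists_eRk_eq_nat (M := M) hX
    rw [hk] at hr ⊢
    have hk3 : k ≤ 3 := by exact_mod_cast hr
    have hcard : X.ncard ≤ k + 3 := by
      rcases Nat.lt_or_ge k 3 with h | h
      · have := ncard_add_one_le_two_pow_of_eRk_le M hL0 hfree k X hX (le_of_eq hk)
        interval_cases k <;> omega
      · have hk' : k = 3 := by omega
        subst hk'
        have := hC2 X hX (le_of_eq hk)
        omega
    exact_mod_cast hcard
  set ν₄ : ℕ := (6 + 3) / 2 + 1 with hν₄
  have hflat4 : ∀ X ⊆ M.E, M.eRk X ≤ 4 → X.ncard ≤ min 10 (4 + 6) := fun X hX hr =>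
    hflat' X hX (by simpa using hr)
  have hflat4' : ∀ X ⊆ M.E, M.eRk X ≤ ((4 - 1 : ℕ) : ℕ∞) → X.ncard ≤ 6 := fun X hX hr =>
    hC2 X hX (by simpa using hr)
  have hD4 := S2.ncard_eRk_eq_ncard_le_le_sets M 4 (min 10 (4 + 6)) 6 ν₄ 3 10 (by norm_num)
    hcirc hC1 hflat4 hflat4' hinter4 hd (by omega) (by omega) (by omega)
  have hm41 : min (min 10 (4 + 6) - 5) (ν₄ - 2) = min 5 ((6 + 3) / 2 + 1 - 2) := by omega
  have hm43 : min (min 10 (4 + 6)) (4 + 6) = 10 := by omega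
  simp only [show (4 : ℕ) + 1 = 5 from rfl] at hD4
  rw [hn, sum_Icc_three_five_q, hm41, hm43, show 10 - 5 + 1 = 6 by norm_num,
    show 10 - 5 = 5 by norm_num] at hD4
  simp only [show (5 : ℕ) - 3 = 2 from rfl, show (5 : ℕ) - 4 = 1 from rfl,
    show (5 : ℕ) - 5 = 0 from rfl, Nat.choose_one_right, Nat.choose_zero_right] at hD4
  have hD4q : ({B : Set α | B ⊆ M.E ∧ M.eRk B = 4 ∧ B.ncard ≤ 10}.ncard : ℚ) ≤ (((p + 6).choose 4 : ℚ) +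
      (∑ j ∈ Finset.range 6, (Nat.choose (min 5 ((6 + 3) / 2 + 1 - 2)) j : ℚ) / (((j + 1) + 3 * (j + 1).choose 2 : ℕ) : ℚ)) *
        ((((6 * 6 + 6 - 3 * 6) / 2) * (p + 6 - 3).choose 2 + S1.fourCircuitBound 6 * (p + 6 - 4) + (6 + 4).choose 5 : ℕ) : ℚ) +
      ((∑ j ∈ Finset.range 6, (Nat.choose 5 j : ℚ) / (((j + 1) + 3 * (j + 1).choose 2 : ℕ) : ℚ)) -
        (∑ j ∈ Finset.range 6, (Nat.choose (min 5 ((6 + 3) / 2 + 1 - 2)) j : ℚ) / (((j + 1) + 3 * (j + 1).choose 2 : ℕ) : ℚ))) *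
        ((10 : ℕ).choose 5 : ℚ)) := by
    have hsm4 : {C | M.IsCircuit C ∧ C.ncard = 3}.ncard * (p + 6 - 3).choose 2 +
        {C | M.IsCircuit C ∧ C.ncard = 4}.ncard * (p + 6 - 4) +
        {C | M.IsCircuit C ∧ C.ncard = 5}.ncard * 1 ≤
        ((6 * 6 + 6 - 3 * 6) / 2) * (p + 6 - 3).choose 2 + S1.fourCircuitBound 6 * (p + 6 - 4) + (6 + 4).choose 5 := by
      have := hs5
      gcongr
      omega
    have hsm4q : (({C | M.IsCircuit C ∧ C.ncard = 3}.ncard : ℚ) * ((p + 6 - 3).choose 2 : ℚ) +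
        ({C | M.IsCircuit C ∧ C.ncard = 4}.ncard : ℚ) * ((p + 6 - 4 : ℕ) : ℚ) +
        ({C | M.IsCircuit C ∧ C.ncard = 5}.ncard : ℚ) * ((1 : ℕ) : ℚ)) ≤
        ((((6 * 6 + 6 - 3 * 6) / 2) * (p + 6 - 3).choose 2 + S1.fourCircuitBound 6 * (p + 6 - 4) +
          (6 + 4).choose 5 : ℕ) : ℚ) := by exact_mod_cast hsm4
    have hσ40 : (0 : ℚ) ≤ ∑ j ∈ Finset.range 6, (Nat.choose (min 5 ((6 + 3) / 2 + 1 - 2)) j : ℚ) / (((j + 1) + 3 * (j + 1).choose 2 : ℕ) : ℚ) :=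
      Finset.sum_nonneg (fun j _ => by positivity)
    refine hD4.trans ?_
    have e1 := mul_le_mul_of_nonneg_left hsm4q hσ40
    linarith
  have h3 : {X : Set α | X ⊆ M.E ∧ M.eRk X = (3 : ℕ)}.ncard ≤ M.E.ncard.choose 3 * 2 ^ (6 - 3) :=
    S2.ncard_eRk_eq_le_choose_mul_two_pow M 3 6
      (fun X hX hr => ncard_le_six_of_eRk_le_three_of_free M hfree hX (by exact_mod_cast hr))
  have h2 : {X : Set α | X ⊆ M.E ∧ M.eRk X = (2 : ℕ)}.ncard ≤ M.E.ncard.choose 2 * 2 ^ (3 - 2) :=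
    S2.ncard_eRk_eq_le_choose_mul_two_pow M 2 3
      (fun X hX hr => by
        have := ncard_add_one_le_two_pow_of_eRk_le M hL0 hfree 2 X hX hr
        omega)
  have h1 : {X : Set α | X ⊆ M.E ∧ M.eRk X = (1 : ℕ)}.ncard ≤ M.E.ncard.choose 1 * 2 ^ (1 - 1) :=
    S2.ncard_eRk_eq_le_choose_mul_two_pow M 1 1
      (fun X hX hr => by
        have := ncard_add_one_le_two_pow_of_eRk_le M hL0 hfree 1 X hX hr
        omega)
  have h0 : {X : Set α | X ⊆ M.E ∧ M.eRk X = (0 : ℕ)}.ncard ≤ M.E.ncard.choose 0 * 2 ^ (0 - 0) :=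
    S2.ncard_eRk_eq_le_choose_mul_two_pow M 0 0
      (fun X hX hr => by
        have := ncard_add_one_le_two_pow_of_eRk_le M hL0 hfree 0 X hX hr
        omega)
  -- the rank-`5` sets have `≤ 5 + 6` points (the nullity cap)
  have h5 : {X : Set α | X ⊆ M.E ∧ M.eRk X = 5}.ncard ≤
      {B : Set α | B ⊆ M.E ∧ M.eRk B = 5 ∧ B.ncard ≤ 5 + 6}.ncard := by
    apply Set.ncard_le_ncard
    · intro X hX
      exact ⟨hX.1, hX.2, ncard_le_add_of_eRk_le_of_encard_eq M hd hX.1 (le_of_eq hX.2)⟩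
    · exact M.ground_finite.finite_subsets.subset (fun B hB => hB.1)
  have hD0 := S2.ncard_eRk_eq_ncard_le_le_sets M 5 (min 19 (5 + 6)) (min 10 (4 + 6)) ν₁ 6 (5 + 6)
    (by norm_num) hcirc hC1 hflat hflat' (hinter_five M hfree) hd (by omega) (by omega) (by omega)
  simp only [show (5 : ℕ) + 1 = 6 from rfl] at hD0
  rw [hn, sum_Icc_three_six_q, hm1, hm3] at hD0
  simp only [show (6 : ℕ) - 3 = 3 from rfl, show (6 : ℕ) - 4 = 2 from rfl,
    show (6 : ℕ) - 5 = 1 from rfl, show (6 : ℕ) - 6 = 0 from rfl, Nat.choose_one_right,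
    Nat.choose_zero_right] at hD0
  have hDq : ({B : Set α | B ⊆ M.E ∧ M.eRk B = 5 ∧ B.ncard ≤ 5 + 6}.ncard : ℚ) ≤ ((p + 6).choose 5 : ℚ) +
      (∑ j ∈ Finset.range (6), (Nat.choose (min 13 ((6 + 6) / 2 + 1 - 2)) j : ℚ) / (((j + 1) + 3 * (j + 1).choose 2 : ℕ) : ℚ)) *
        ((((6 * 6 + 6 - 3 * 6) / 2) * (p + 6 - 3).choose 3 + S1.fourCircuitBound 6 * (p + 6 - 4).choose 2 +
          (6 + 4).choose 5 * (p + 6 - 5) + (6 + 5).choose 6 : ℕ) : ℚ) +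
      ((∑ j ∈ Finset.range (6), (Nat.choose (min 19 (5 + 6) - 6) j : ℚ) / (((j + 1) + 3 * (j + 1).choose 2 : ℕ) : ℚ)) -
        (∑ j ∈ Finset.range (6), (Nat.choose (min 13 ((6 + 6) / 2 + 1 - 2)) j : ℚ) / (((j + 1) + 3 * (j + 1).choose 2 : ℕ) : ℚ))) *
        ((min 19 (5 + 6)).choose 6 : ℚ) := by
    have hsm : {C | M.IsCircuit C ∧ C.ncard = 3}.ncard * (p + 6 - 3).choose 3 +
        {C | M.IsCircuit C ∧ C.ncard = 4}.ncard * (p + 6 - 4).choose 2 +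
        {C | M.IsCircuit C ∧ C.ncard = 5}.ncard * (p + 6 - 5) + {C | M.IsCircuit C ∧ C.ncard = 6}.ncard * 1 ≤
        ((6 * 6 + 6 - 3 * 6) / 2) * (p + 6 - 3).choose 3 + S1.fourCircuitBound 6 * (p + 6 - 4).choose 2 +
          (6 + 4).choose 5 * (p + 6 - 5) + (6 + 5).choose 6 := by
      have := hs6
      gcongr
      omega
    have hsmq : (({C | M.IsCircuit C ∧ C.ncard = 3}.ncard : ℚ) * ((p + 6 - 3).choose 3 : ℚ) +
        ({C | M.IsCircuit C ∧ C.ncard = 4}.ncard : ℚ) * ((p + 6 - 4).choose 2 : ℚ) +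
        ({C | M.IsCircuit C ∧ C.ncard = 5}.ncard : ℚ) * ((p + 6 - 5 : ℕ) : ℚ) +
        ({C | M.IsCircuit C ∧ C.ncard = 6}.ncard : ℚ) * ((1 : ℕ) : ℚ)) ≤
        ((((6 * 6 + 6 - 3 * 6) / 2) * (p + 6 - 3).choose 3 + S1.fourCircuitBound 6 * (p + 6 - 4).choose 2 +
          (6 + 4).choose 5 * (p + 6 - 5) + (6 + 5).choose 6 : ℕ) : ℚ) := by exact_mod_cast hsm
    have hσm0 : (0 : ℚ) ≤ ∑ j ∈ Finset.range (6), (Nat.choose (min 13 ((6 + 6) / 2 + 1 - 2)) j : ℚ) / (((j + 1) + 3 * (j + 1).choose 2 : ℕ) : ℚ) :=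
      Finset.sum_nonneg (fun j _ => by positivity)
    refine hD0.trans ?_
    have e1 := mul_le_mul_of_nonneg_left hsmq hσm0
    linarith
  have hB := Matroid.ncard_spanning_le (M := M) hd
  rw [hEcard] at hY hB
  have hΦ := phiK_le_two_pow_div p 5
  rw [Nat.choose_symm_add] at hΦ
  rw [RLS_iff]
  have hYq : (2 : ℚ) ^ (p + 6) ≤ (Matroid.midCount M p 5 : ℚ) +
      ({X : Set α | X ⊆ M.E ∧ M.eRk X ≤ 5}.ncard : ℚ) +
      ({X : Set α | X ⊆ M.E ∧ M.eRk X = M.eRank}.ncard : ℚ) := by exact_mod_cast hY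
  have hU0' : (0 : ℚ) ≤ (Matroid.topCount M p 5 : ℚ) := Nat.cast_nonneg _
  -- `#{r ≤ 5} ≤ F₄(n) + count₅` in `ℚ`
  norm_num [Nat.choose_one_right] at h3 h2 h1 h0
  rw [hn] at h3 h2 h1
  have hAq : ({X : Set α | X ⊆ M.E ∧ M.eRk X ≤ 5}.ncard : ℚ) ≤
      (((p + 6).choose 4 : ℚ) +
      (∑ j ∈ Finset.range 6, (Nat.choose (min 5 ((6 + 3) / 2 + 1 - 2)) j : ℚ) / (((j + 1) + 3 * (j + 1).choose 2 : ℕ) : ℚ)) *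
        ((((6 * 6 + 6 - 3 * 6) / 2) * (p + 6 - 3).choose 2 + S1.fourCircuitBound 6 * (p + 6 - 4) + (6 + 4).choose 5 : ℕ) : ℚ) +
      ((∑ j ∈ Finset.range 6, (Nat.choose 5 j : ℚ) / (((j + 1) + 3 * (j + 1).choose 2 : ℕ) : ℚ)) -
        (∑ j ∈ Finset.range 6, (Nat.choose (min 5 ((6 + 3) / 2 + 1 - 2)) j : ℚ) / (((j + 1) + 3 * (j + 1).choose 2 : ℕ) : ℚ))) *
        ((10 : ℕ).choose 5 : ℚ)) +
      (((p + 6).choose 3 * 2 ^ 3 + (p + 6).choose 2 * 2 + (p + 6) + 1 : ℕ) : ℚ) +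
      (((p + 6).choose 5 : ℚ) +
        (∑ j ∈ Finset.range (6), (Nat.choose (min 13 ((6 + 6) / 2 + 1 - 2)) j : ℚ) / (((j + 1) + 3 * (j + 1).choose 2 : ℕ) : ℚ)) *
          ((((6 * 6 + 6 - 3 * 6) / 2) * (p + 6 - 3).choose 3 + S1.fourCircuitBound 6 * (p + 6 - 4).choose 2 +
            (6 + 4).choose 5 * (p + 6 - 5) + (6 + 5).choose 6 : ℕ) : ℚ) +
        ((∑ j ∈ Finset.range (6), (Nat.choose (min 19 (5 + 6) - 6) j : ℚ) / (((j + 1) + 3 * (j + 1).choose 2 : ℕ) : ℚ)) -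
          (∑ j ∈ Finset.range (6), (Nat.choose (min 13 ((6 + 6) / 2 + 1 - 2)) j : ℚ) / (((j + 1) + 3 * (j + 1).choose 2 : ℕ) : ℚ))) *
        ((min 19 (5 + 6)).choose 6 : ℚ)) := by
    have hA4 : {X : Set α | X ⊆ M.E ∧ M.eRk X ≤ 5}.ncard ≤
        {B : Set α | B ⊆ M.E ∧ M.eRk B = 4 ∧ B.ncard ≤ 10}.ncard +
        ((p + 6).choose 3 * 2 ^ 3 + (p + 6).choose 2 * 2 + (p + 6) + 1) +
        {B : Set α | B ⊆ M.E ∧ M.eRk B = 5 ∧ B.ncard ≤ 5 + 6}.ncard := by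
      push_cast at hsum5
      omega
    have hA4q : ({X : Set α | X ⊆ M.E ∧ M.eRk X ≤ 5}.ncard : ℚ) ≤
        ({B : Set α | B ⊆ M.E ∧ M.eRk B = 4 ∧ B.ncard ≤ 10}.ncard : ℚ) +
        (((p + 6).choose 3 * 2 ^ 3 + (p + 6).choose 2 * 2 + (p + 6) + 1 : ℕ) : ℚ) +
        ({B : Set α | B ⊆ M.E ∧ M.eRk B = 5 ∧ B.ncard ≤ 5 + 6}.ncard : ℚ) := by exact_mod_cast hA4
    exact hA4q.trans (add_le_add (add_le_add hD4q le_rfl) hDq)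
  have hBq : ({X : Set α | X ⊆ M.E ∧ M.eRk X = M.eRank}.ncard : ℚ) ≤
      ((∑ j ∈ Finset.range (6 + 1), (p + 6).choose j : ℕ) : ℚ) := by exact_mod_cast hB
  obtain ⟨m, hm, hpolyall, htail29⟩ := hcell
  have hpoly29 := hpolyall t (Finset.mem_range.2 (by omega))
  have hABq : (1024 : ℚ) * (({X : Set α | X ⊆ M.E ∧ M.eRk X ≤ 5}.ncard : ℚ) +
      ({X : Set α | X ⊆ M.E ∧ M.eRk X = M.eRank}.ncard : ℚ)) ≤ (m : ℚ) * 2 ^ (p + 6) := by linarith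
  exact hslack hΦ hU0' hUq hYq hm hABq hpoly29


end ThmN

end PercRepro
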